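import Mathlib
import HarnessLib

/-!
# Averages of the odd singular product `g(m) = ∏_{p ∣ m, p > 2} (p − 1)/(p − 2)`

Topic `Literature/NumberTheory/Sieve`. Everything here is PROVED (Mathlib only). This is the
elementary engine behind Lemma 4 of J. Maynard, *Large gaps between primes* (arXiv:1408.5110, §2):
there `|𝓡_m| ≍ (U/(m log x log y)) · ∏_{p ∣ m, p > 2} (p − 1)/(p − 2)` (Lemma 3, by Mertens), and
Lemma 4, `Σ_{U/(zM) ≤ m < U/z} |𝓡_m| ≪ U log M/((log x)(log y))`, is the statement that the
multiplicative weight `g(m)` is bounded on average over every dyadic range: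

* `sum_oddSingProd_le`      : `Σ_{1 ≤ m ≤ X} g(m) ≤ 2X` (write `(p−1)/(p−2) = 1 + 1/(p−2)`, expand
  the product over the odd prime factors into a sum over their subsets `t`, exchange, count the
  multiples of `∏ t` in `[1, X]`, and bound `∏_{2 < p ≤ X} (1 + 1/((p−2)p)) ≤
  ∏_{3 ≤ n ≤ X} (1 + 1/((n−2)n)) = 2(X−1)/X < 2` — a telescoping product);
* `sum_Ico_oddSingProd_div_le_four` : `Σ_{A ≤ m < 2A} g(m)/m ≤ 4`;
* `sum_Ico_oddSingProd_div_le`      : `Σ_{A ≤ m < B} g(m)/m ≤ 4 log(B/A)/log 2 + 4` (`1 ≤ A ≤ B`).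

It is filed for the seat plan of the large-gaps ladder (`LargeGapsBetweenPrimes.lean`,
`Maynard2016LargeGapsStatements.lean`: block [M-b], `Maynard2016.Lemma4` from `Maynard2016.Lemma3`).

## References

* J. Maynard, *Large gaps between primes*, Ann. of Math. (2) 183 (2016), 915–933; arXiv:1408.5110,
  §2, Lemma 4 and its proof. [Maynard2016LargeGaps]
* H. L. Montgomery, R. C. Vaughan, *Multiplicative Number Theory I*, CUP 2007, §2.1 (elementary
  mean values of multiplicative functions). [MontgomeryVaughan2007]
-/

open Finset

namespace Literature.NumberTheory.Sieve

namespace SingularProductAverage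

/-- The odd singular product `g(m) = ∏_{p ∣ m, p > 2} (p − 1)/(p − 2)` (for even `m`,
`∏_{p ≤ y, p ∤ m} (p−2)/(p−1) = g_y(m) · ∏_{2 < p ≤ y} (p−2)/(p−1)` with `g_y ≤ g`).
[cite: Maynard2016LargeGaps, §2, Lemma 3 (second display)] -/
noncomputable def oddSingProd (m : ℕ) : ℝ :=
  ∏ p ∈ m.primeFactors.filter (fun p => 2 < p), (((p : ℝ) - 1) / ((p : ℝ) - 2))

/-- `g(m) ≥ 0`. [cite: Maynard2016LargeGaps, §2, Lemma 3 (second display: the factor `∏_{p|m,p>2}(p−1)/(p−2)`)] -/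
theorem oddSingProd_nonneg (m : ℕ) : 0 ≤ oddSingProd m :=
  prod_nonneg fun p hp => by
    have h3 : (3 : ℝ) ≤ p := by exact_mod_cast (mem_filter.1 hp).2
    exact div_nonneg (by linarith) (by linarith)

/-- `g(m) ≥ 1`. [cite: Maynard2016LargeGaps, §2, Lemma 3 (second display)] -/
theorem one_le_oddSingProd (m : ℕ) : 1 ≤ oddSingProd m := by
  rw [oddSingProd]
  have h : ∏ p ∈ m.primeFactors.filter (fun p => 2 < p), (1 : ℝ) ≤
      ∏ p ∈ m.primeFactors.filter (fun p => 2 < p), (((p : ℝ) - 1) / ((p : ℝ) - 2)) :=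
    prod_le_prod (fun _ _ => zero_le_one) fun p hp => by
      have h3 : (3 : ℝ) ≤ p := by exact_mod_cast (mem_filter.1 hp).2
      rw [le_div_iff₀ (by linarith)]; linarith
  simpa using h

/-- `(p−1)/(p−2) = 1 + 1/(p−2)` factorwise. [cite: Maynard2016LargeGaps, §2, proof of Lemma 4] -/
theorem oddSingProd_eq (m : ℕ) :
    oddSingProd m = ∏ p ∈ m.primeFactors.filter (fun p => 2 < p), (1 + 1 / ((p : ℝ) - 2)) := by
  refine prod_congr rfl fun p hp => ?_
  have h3 : (3 : ℝ) ≤ p := by exact_mod_cast (mem_filter.1 hp).2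
  have hne : (p : ℝ) - 2 ≠ 0 := by linarith
  field_simp
  ring

/-- The telescoping product `∏_{3 ≤ n ≤ N} (1 + 1/((n−2)n)) = 2(N−1)/N` (`N ≥ 2`). [folklore] -/
private theorem prod_Icc_three_eq (N : ℕ) (hN : 2 ≤ N) :
    ∏ n ∈ Icc 3 N, (1 + 1 / (((n : ℝ) - 2) * n)) = 2 * ((N : ℝ) - 1) / N := by
  induction N, hN using Nat.le_induction with
  | base => norm_num
  | succ N hN ih =>
      rw [Finset.prod_Icc_succ_top (by omega : 3 ≤ N + 1), ih]
      have h2 : (2 : ℝ) ≤ N := by exact_mod_cast hN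
      have h0 : (N : ℝ) ≠ 0 := by positivity
      have h1 : (N : ℝ) + 1 - 2 ≠ 0 := by linarith
      have h4 : (N : ℝ) + 1 ≠ 0 := by linarith
      push_cast
      rw [div_mul_eq_mul_div, div_eq_div_iff h0 h4]
      field_simp
      ring

/-- `∏_{3 ≤ n ≤ X} (1 + 1/((n−2)n)) ≤ 2`. [folklore] -/
private theorem prod_Icc_three_le (X : ℕ) : ∏ n ∈ Icc 3 X, (1 + 1 / (((n : ℝ) - 2) * n)) ≤ 2 := by
  rcases le_or_gt 2 X with hX | hX
  · rw [prod_Icc_three_eq X hX]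
    have h0 : (0 : ℝ) < X := by exact_mod_cast (show 0 < X by omega)
    rw [div_le_iff₀ h0]; linarith
  · have : Icc 3 X = ∅ := Finset.Icc_eq_empty (by omega)
    rw [this, prod_empty]; norm_num

/-- **`Σ_{1 ≤ m ≤ X} g(m) ≤ 2X`.** [cite: Maynard2016LargeGaps, §2, proof of Lemma 4
(«the bound `Σ_m ∏_{p|m}(p−1)/(p−2)/m ≪ log M`»); MontgomeryVaughan2007, §2.1] -/
theorem sum_oddSingProd_le (X : ℕ) : ∑ m ∈ Ioc 0 X, oddSingProd m ≤ 2 * X := by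
  classical
  -- the odd primes `≤ X`
  set P : Finset ℕ := (Finset.range (X + 1)).filter (fun p => p.Prime ∧ 2 < p) with hP
  have hSP : ∀ m ∈ Ioc 0 X, m.primeFactors.filter (fun p => 2 < p) ⊆ P := by
    intro m hm p hp
    rw [mem_filter] at hp
    rw [hP, mem_filter, mem_range]
    have h := Nat.mem_primeFactors.1 hp.1
    exact ⟨Nat.lt_succ_of_le ((Nat.le_of_dvd (mem_Ioc.1 hm).1 h.2.1).trans (mem_Ioc.1 hm).2),
      h.1, hp.2⟩
  -- weights `w t = ∏_{p ∈ t} 1/(p−2) ≥ 0`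
  have hw0 : ∀ t ∈ P.powerset, (0 : ℝ) ≤ ∏ p ∈ t, (1 / ((p : ℝ) - 2)) := by
    intro t ht
    refine prod_nonneg fun p hp => ?_
    have h3 : (3 : ℝ) ≤ p := by exact_mod_cast (mem_filter.1 (mem_powerset.1 ht hp)).2.2
    exact div_nonneg zero_le_one (by linarith)
  -- step 1: `g(m) = Σ_{t ⊆ P} [t ⊆ S(m)] w t`
  have h1 : ∀ m ∈ Ioc 0 X, oddSingProd m = ∑ t ∈ P.powerset,
      (if t ⊆ m.primeFactors.filter (fun p => 2 < p) then ∏ p ∈ t, (1 / ((p : ℝ) - 2))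
        else 0) := by
    intro m hm
    rw [oddSingProd_eq, prod_one_add, ← sum_filter]
    refine sum_congr ?_ fun _ _ => rfl
    ext t
    rw [mem_powerset, mem_filter, mem_powerset]
    exact ⟨fun h => ⟨h.trans (hSP m hm), h⟩, fun h => h.2⟩
  -- step 2: the count of `m ≤ X` with `t ⊆ S(m)` is `≤ X/∏ t`
  have h2 : ∀ t ∈ P.powerset,
      ((((Ioc 0 X).filter (fun m => t ⊆ m.primeFactors.filter (fun p => 2 < p))).card : ℝ)) ≤
        (X : ℝ) / ∏ p ∈ t, (p : ℝ) := by
    intro t ht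
    have htP : t ⊆ P := mem_powerset.1 ht
    have hprime : ∀ p ∈ t, p.Prime := fun p hp => (mem_filter.1 (htP hp)).2.1
    have hsub : (Ioc 0 X).filter (fun m => t ⊆ m.primeFactors.filter (fun p => 2 < p)) ⊆
        (Ioc 0 X).filter (fun m => (∏ p ∈ t, p) ∣ m) := by
      intro m hm
      rw [mem_filter] at hm ⊢
      refine ⟨hm.1, Finset.prod_primes_dvd m (fun p hp => Nat.prime_iff.1 (hprime p hp))
        fun p hp => ?_⟩
      exact (Nat.mem_primeFactors.1 (mem_filter.1 (hm.2 hp)).1).2.1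
    have hcard := card_le_card hsub
    rw [Nat.Ioc_filter_dvd_card_eq_div] at hcard
    have hpos : (0 : ℝ) < ∏ p ∈ t, (p : ℝ) :=
      prod_pos fun p hp => by exact_mod_cast (hprime p hp).pos
    calc ((((Ioc 0 X).filter (fun m => t ⊆ m.primeFactors.filter (fun p => 2 < p))).card : ℝ))
        ≤ ((X / ∏ p ∈ t, p : ℕ) : ℝ) := by exact_mod_cast hcard
      _ ≤ (X : ℝ) / ((∏ p ∈ t, p : ℕ) : ℝ) := Nat.cast_div_le
      _ = (X : ℝ) / ∏ p ∈ t, (p : ℝ) := by rw [Nat.cast_prod]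
  -- step 3: `∏ 1/(p−2) · (X/∏ p) = X · ∏ 1/((p−2)p)`
  have h3 : ∀ t : Finset ℕ, (∏ p ∈ t, (1 / ((p : ℝ) - 2))) * ((X : ℝ) / ∏ p ∈ t, (p : ℝ)) =
      (X : ℝ) * ∏ p ∈ t, (1 / (((p : ℝ) - 2) * p)) := by
    intro t
    have : ∏ p ∈ t, (1 / (((p : ℝ) - 2) * p)) =
        (∏ p ∈ t, (1 / ((p : ℝ) - 2))) * ∏ p ∈ t, (1 / (p : ℝ)) := by
      rw [← prod_mul_distrib]
      exact prod_congr rfl fun p _ => by rw [one_div_mul_one_div]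
    have hinv : ∏ p ∈ t, (1 / (p : ℝ)) = 1 / ∏ p ∈ t, (p : ℝ) := by
      rw [prod_div_distrib, prod_const_one]
    rw [this, hinv]
    ring
  -- step 4: the Euler product over the odd primes `≤ X` is `≤ 2`
  have h4 : ∏ p ∈ P, (1 + 1 / (((p : ℝ) - 2) * p)) ≤ 2 := by
    have hsub : P ⊆ Icc 3 X := by
      intro p hp
      rw [hP, mem_filter, mem_range] at hp
      rw [mem_Icc]; omega
    have hfac : ∀ n ∈ Icc 3 X, (1 : ℝ) ≤ 1 + 1 / (((n : ℝ) - 2) * n) := by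
      intro n hn
      have h3 : (3 : ℝ) ≤ n := by exact_mod_cast (mem_Icc.1 hn).1
      have : (0 : ℝ) ≤ 1 / (((n : ℝ) - 2) * n) := div_nonneg zero_le_one (by nlinarith)
      linarith
    have hrest : (1 : ℝ) ≤ ∏ n ∈ Icc 3 X \ P, (1 + 1 / (((n : ℝ) - 2) * n)) := by
      have h := prod_le_prod (s := Icc 3 X \ P) (fun _ _ => zero_le_one)
        fun n hn => hfac n (mem_sdiff.1 hn).1
      simpa using h
    have hP0 : (0 : ℝ) ≤ ∏ p ∈ P, (1 + 1 / (((p : ℝ) - 2) * p)) :=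
      prod_nonneg fun p hp => le_trans zero_le_one (hfac p (hsub hp))
    calc ∏ p ∈ P, (1 + 1 / (((p : ℝ) - 2) * p))
        ≤ (∏ n ∈ Icc 3 X \ P, (1 + 1 / (((n : ℝ) - 2) * n))) *
            ∏ p ∈ P, (1 + 1 / (((p : ℝ) - 2) * p)) := le_mul_of_one_le_left hP0 hrest
      _ = ∏ n ∈ Icc 3 X, (1 + 1 / (((n : ℝ) - 2) * n)) := prod_sdiff hsub
      _ ≤ 2 := prod_Icc_three_le X
  -- assemble
  calc ∑ m ∈ Ioc 0 X, oddSingProd m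
      = ∑ m ∈ Ioc 0 X, ∑ t ∈ P.powerset,
          (if t ⊆ m.primeFactors.filter (fun p => 2 < p) then ∏ p ∈ t, (1 / ((p : ℝ) - 2))
            else 0) := sum_congr rfl h1
    _ = ∑ t ∈ P.powerset, ∑ m ∈ Ioc 0 X,
          (if t ⊆ m.primeFactors.filter (fun p => 2 < p) then ∏ p ∈ t, (1 / ((p : ℝ) - 2))
            else 0) := sum_comm
    _ = ∑ t ∈ P.powerset, (∏ p ∈ t, (1 / ((p : ℝ) - 2))) *
          ((((Ioc 0 X).filter (fun m => t ⊆ m.primeFactors.filter (fun p => 2 < p))).card : ℝ)) := by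
        refine sum_congr rfl fun t _ => ?_
        rw [← sum_filter, sum_const, nsmul_eq_mul, mul_comm]
    _ ≤ ∑ t ∈ P.powerset, (∏ p ∈ t, (1 / ((p : ℝ) - 2))) * ((X : ℝ) / ∏ p ∈ t, (p : ℝ)) :=
        sum_le_sum fun t ht => mul_le_mul_of_nonneg_left (h2 t ht) (hw0 t ht)
    _ = (X : ℝ) * ∑ t ∈ P.powerset, ∏ p ∈ t, (1 / (((p : ℝ) - 2) * p)) := by
        rw [mul_sum]; exact sum_congr rfl fun t _ => h3 t
    _ = (X : ℝ) * ∏ p ∈ P, (1 + 1 / (((p : ℝ) - 2) * p)) := by rw [prod_one_add]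
    _ ≤ (X : ℝ) * 2 := mul_le_mul_of_nonneg_left h4 (Nat.cast_nonneg X)
    _ = 2 * X := mul_comm _ _

/-- **One dyadic block: `Σ_{A ≤ m < 2A} g(m)/m ≤ 4`.** [cite: Maynard2016LargeGaps, §2, proof of
Lemma 4] -/
theorem sum_Ico_oddSingProd_div_le_four (A : ℕ) (hA : 1 ≤ A) :
    ∑ m ∈ Ico A (2 * A), oddSingProd m / m ≤ 4 := by
  have hA0 : (0 : ℝ) < A := by exact_mod_cast hA
  calc ∑ m ∈ Ico A (2 * A), oddSingProd m / m
      ≤ ∑ m ∈ Ico A (2 * A), oddSingProd m / A :=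
        sum_le_sum fun m hm => div_le_div_of_nonneg_left (oddSingProd_nonneg m) hA0
          (by exact_mod_cast (mem_Ico.1 hm).1)
    _ = (∑ m ∈ Ico A (2 * A), oddSingProd m) / A := by rw [sum_div]
    _ ≤ (∑ m ∈ Ioc 0 (2 * A), oddSingProd m) / A := by
        refine div_le_div_of_nonneg_right (sum_le_sum_of_subset_of_nonneg ?_
          fun m _ _ => oddSingProd_nonneg m) hA0.le
        intro m hm
        rw [mem_Ico] at hm; rw [mem_Ioc]; omega
    _ ≤ 2 * ((2 * A : ℕ) : ℝ) / A := div_le_div_of_nonneg_right (sum_oddSingProd_le _) hA0.le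
    _ = 4 := by rw [div_eq_iff hA0.ne']; push_cast; ring

/-- `J` dyadic blocks: `Σ_{A ≤ m < 2^J A} g(m)/m ≤ 4J`. [cite: Maynard2016LargeGaps, §2, proof of
Lemma 4 (dyadic decomposition of `Σ_m ∏_{p|m}(p−1)/(p−2)/m ≪ log M`)] -/
theorem sum_Ico_pow_mul_oddSingProd_div_le (A : ℕ) (hA : 1 ≤ A) (J : ℕ) :
    ∑ m ∈ Ico A (2 ^ J * A), oddSingProd m / m ≤ 4 * J := by
  induction J with
  | zero => simp
  | succ J ih =>
      have h2J : 0 < 2 ^ J := by positivity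
      have hle1 : A ≤ 2 ^ J * A := Nat.le_mul_of_pos_left A h2J
      have hle2 : 2 ^ J * A ≤ 2 ^ (J + 1) * A := by
        rw [pow_succ]; nlinarith
      rw [← Finset.Ico_union_Ico_eq_Ico hle1 hle2,
        sum_union (Ico_disjoint_Ico_consecutive A (2 ^ J * A) (2 ^ (J + 1) * A))]
      have hblock := sum_Ico_oddSingProd_div_le_four (2 ^ J * A) (le_trans hA hle1)
      rw [show 2 * (2 ^ J * A) = 2 ^ (J + 1) * A by ring] at hblock
      push_cast
      linarith

/-- **`Σ_{A ≤ m < B} g(m)/m ≤ 4 log(B/A)/log 2 + 4`** for `1 ≤ A ≤ B` — the form used in Lemma 4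
(`M = B/A`: `≪ log M` for `M ≥ 2`). [cite: Maynard2016LargeGaps, §2, proof of Lemma 4] -/
theorem sum_Ico_oddSingProd_div_le {A B : ℕ} (hA : 1 ≤ A) (hAB : A ≤ B) :
    ∑ m ∈ Ico A B, oddSingProd m / m ≤
      4 * (Real.log B - Real.log A) / Real.log 2 + 4 := by
  -- `J = ⌊log₂ (B/A)⌋ + 1` blocks reach past `B`
  set q : ℕ := B / A with hq
  have hq1 : 1 ≤ q := by rw [hq]; exact Nat.div_pos hAB hA
  have hBlt : B < 2 ^ (Nat.log 2 q + 1) * A := by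
    have h1 : q < 2 ^ (Nat.log 2 q + 1) := Nat.lt_pow_succ_log_self (by norm_num) q
    have h2 : B < (q + 1) * A := by
      rw [hq, add_mul, one_mul]; exact Nat.lt_div_mul_add hA
    calc B < (q + 1) * A := h2
      _ ≤ 2 ^ (Nat.log 2 q + 1) * A := Nat.mul_le_mul_right A h1
  have hsum : ∑ m ∈ Ico A B, oddSingProd m / m ≤
      ∑ m ∈ Ico A (2 ^ (Nat.log 2 q + 1) * A), oddSingProd m / m :=
    sum_le_sum_of_subset_of_nonneg (Ico_subset_Ico_right hBlt.le)
      fun m _ _ => div_nonneg (oddSingProd_nonneg m) (Nat.cast_nonneg m)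
  have hJ := sum_Ico_pow_mul_oddSingProd_div_le A hA (Nat.log 2 q + 1)
  -- `Nat.log 2 q ≤ log q/log 2 ≤ (log B − log A)/log 2`
  have hlog2 : 0 < Real.log 2 := Real.log_pos one_lt_two
  have hA0 : (0 : ℝ) < A := by exact_mod_cast hA
  have hq0 : (0 : ℝ) < q := by exact_mod_cast hq1
  have hlogq : (Nat.log 2 q : ℝ) * Real.log 2 ≤ Real.log B - Real.log A := by
    have h1 : ((2 ^ Nat.log 2 q : ℕ) : ℝ) ≤ q := by
      exact_mod_cast Nat.pow_log_le_self 2 (by omega : q ≠ 0)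
    have h2 : (Nat.log 2 q : ℝ) * Real.log 2 = Real.log ((2 ^ Nat.log 2 q : ℕ) : ℝ) := by
      push_cast; rw [Real.log_pow]
    have h3 : Real.log ((2 ^ Nat.log 2 q : ℕ) : ℝ) ≤ Real.log q :=
      Real.log_le_log (by positivity) h1
    have h4 : (q : ℝ) ≤ (B : ℝ) / A := by rw [hq]; exact Nat.cast_div_le
    have h5 : Real.log q ≤ Real.log ((B : ℝ) / A) := Real.log_le_log hq0 h4
    have hB0 : (0 : ℝ) < B := by exact_mod_cast lt_of_lt_of_le hA hAB
    rw [Real.log_div hB0.ne' hA0.ne'] at h5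
    linarith
  have hJle : ((Nat.log 2 q + 1 : ℕ) : ℝ) ≤ (Real.log B - Real.log A) / Real.log 2 + 1 := by
    push_cast
    rw [div_add_one hlog2.ne', le_div_iff₀ hlog2]
    linarith
  calc ∑ m ∈ Ico A B, oddSingProd m / m
      ≤ 4 * ((Nat.log 2 q + 1 : ℕ) : ℝ) := hsum.trans hJ
    _ ≤ 4 * ((Real.log B - Real.log A) / Real.log 2 + 1) :=
        mul_le_mul_of_nonneg_left hJle (by norm_num)
    _ = 4 * (Real.log B - Real.log A) / Real.log 2 + 4 := by ring

end SingularProductAverage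

end Literature.NumberTheory.Sieve
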